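import Summits.QuantumFields.BalabanUV.Beta.FP.GaugeTermRoadLegs
import Summits.QuantumFields.BalabanUV.Beta.FP.PerfectFFBlockRowDiff

/-!
# `BalabanUV.Beta.FP.GaugeTermRoadLegsCol` — road «FP» (binder row D1), lane IR-5′, **THE (R1) GAUGE TERM AT THE ROAD's THREE LEGS, COLUMN LETTERS:
# RHOA-3's `hR1′` AND `hR2` CONDITIONAL ON ONE DISPLAYED TOWER LETTER** — the generic three-leg engine `FP/LegRemainderGaugeTerm`
# (`abs_rho_sub_right_le` = hR1′, `abs_rho_sub_sub_le` = hR2) INSTANTIATED at the free gradient leg `F_μ`, the coarse leg `S_ν` (`GaugeTermRoadLegs.letter_S0 ∕ letter_S1`)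
# and the long leg `Γ_m = ` the ff block of `KPerf … m`, whose column-DIFFERENCE letter (T1′) `T₁ = (C₁∕2)·n` is F5b's `PerfectFFBlockRowDiff.sum_abs_KPerf_ff_colDiff_le`
# — CONDITIONAL on the GRADIENT row-sum letter `Σ_j ‖𝒞(i+ê_μ) j − 𝒞 i j‖ ≤ C₁∕N` of the hard covariance on the tower tori, DISPLAYED in every signature:
# `|ρ p (w+e_j) − ρ p w| ≤ B₁′∕n³`, `|ρ(p+e_i)(w+e_j) − ρ p (w+e_j) − ρ (p+e_i) w + ρ p w| ≤ B₂∕n⁴`, `n = Lc^m`, ONE constant for all `m ≥ 1` (odd `Lc > 1`)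

HONEST DEPENDENCY (page 1, mandatory): continuum YM on T⁴ ⇐ BetaPertH ∧ nine spine estimates (0/9 proved); BetaPertH ⇐ (D1) ∧ (D4) ∧
CAP+tail; G-an2-4 gates asym, D1 and NE2/3/4.  HONEST FRAMING (cell contract, verbatim): «discharging `BetaPertH` makes Bałaban's UV
stability UNCONDITIONAL — a real constructive-QFT result; it is NOT the continuum limit and NOT the Clay problem.»  THIS MODULE is bookkeeping
BY NAME over kernel theorems of the tree (the engine g18, `GaugeTermRoadLegs` g20's leg letters and (T0′) `PerfectFFBlockRowSum` g19) and F5b; it cites nothing,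
mints no `def … : Prop`, declares no data `def`, 0 sorry.  With `GaugeTermRoadLegs` (hR0 ∕ hR1 UNCONDITIONAL) the four RHOA-3 letters of the (R1) gauge term
are now: hR0 ✓, hR1 ✓, hR1′ ⟸ C₁, hR2 ⟸ C₁ — ONE displayed letter, (1.115)'s SECOND entry «|∇GJ| ≤ O(1)|J|» (B5 = Bałaban, CMP 95 (1984) p. 36) for the HARD
covariance 𝒞 in row-sum currency (suppliers: (1.115)'s second entry for the VECTOR `G = Δ_1⁻¹` — in the tree on cubic tori, assembled in F5e `CovarianceRowDiffTower` —
and a log-free gradient row-sum bound for the COMPOSITE gauge factor `∂Δ⁻¹RΔ⁻¹∂ᴴ`, NOT in the tree; F5e reduces `hC1` to that one letter).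
WHAT IT IS NOT: NOT the letter; NOT the identification of the END's leg remainder with the (R1) sum (owner's located conjecture R-γ-18 (ii)); NOT the constraint term;
NOT hslice, NOT (ASYMP), NOT D1, NOT BetaPertH, NOT continuum, NOT Clay.

ABSOLUTE RULE (cell charter, verbatim): «No internally-minted statement may enter as a cited fact. Every hypothesis is either kernel-proved in this
package or a verbatim quotation of a PUBLISHED theorem with page reference. The manuscript(s) under audit are NOT citable for their own disputed
steps — they are the thing under adjudication; programme-internal (2001/route/tribunal) claims are never citable.»

CONTENT (`Pt = ℤ⁴`; road: `d = 3`, odd `Lc > 1`, `n = Lc^m`, `m ≥ 1`).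
* §1 the products of constants with a LINEAR Γ-letter `T₁ = A₁·n`: `prod_zero_lin_le` (`… ≤ (1+80∕κ)·c·33·|A₁|·n⁻³`), `prod_one_lin_le` (`… ≤ (1+80∕κ)·c·33²·|A₁|·n⁻⁴`).
* §2 **`exists_abs_rho_road_sub_right_le`** (hR1′: `∃ B₁′ ∀ m ≥ 1 ∀ μ ν l j p w, |ρ p (w+e_j) − ρ p w| ≤ B₁′∕((Lc)^m)³`),
  **`exists_abs_rho_road_sub_sub_le`** (hR2: `∃ B₂ …, |ρ(p+e_i)(w+e_j) − ρ p (w+e_j) − ρ (p+e_i) w + ρ p w| ≤ B₂∕((Lc)^m)⁴`), both CONDITIONAL on the tower letter;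
  §3 the `ν`-summed twins (constants ×4).
Unit `b2b-balaban-beta-d1-formalise-leaf-05` (gen 22; D1 formalisation swarm leaf seat, road FP lane IR-5′), 2026-08-21; `LEAVES-FP.md` row
«(R1) GAUGE TERM AT THE ROAD's LEGS — COLUMN LETTERS».  «not in print; our bookkeeping».
-/

noncomputable section

namespace Summit.QuantumFields.BalabanUV.Beta.FP.GaugeTermRoadLegsCol

open Finset Real
open scoped BigOperators
open Literature.MathematicalPhysics.QuantumFieldTheory.Balaban1983to89
open Literature.MathematicalPhysics.QuantumFieldTheory.Balaban1983to89.Beta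
open Literature.MathematicalPhysics.QuantumFieldTheory.Balaban1983to89.Beta.DyadicShell (Pt supNorm)
open Literature.MathematicalPhysics.QuantumFieldTheory.Balaban1983to89.Beta.BubbleTransfer (c4 c4_pos)
open Literature.MathematicalPhysics.QuantumFieldTheory.Balaban1983to89.Beta.TwoPowerLegs (free)
open Literature.MathematicalPhysics.QuantumFieldTheory.Balaban1983to89.Beta.AffineAveraging (unitVec)
open Literature.Probability.LatticeModels (latticeGreen)
open B5Prop11Plancherel (Tor fine)
open FluctuationProjection (Cov)
open B5SiteBridgeP12 (nP MP one_le_nP)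
open Summit.QuantumFields.BalabanUV.Beta.GAN24.CombesThomas (sfStep smStep)
open Summit.QuantumFields.BalabanUV.Beta.FP.PerfectObjectsT (KPerf)
open Summit.QuantumFields.BalabanUV.Beta.FP.SliceProjectorKernel (piC)
open Summit.QuantumFields.BalabanUV.Beta.FP.SliceProjectorMidInv (kapY kapY_pos)
open Summit.QuantumFields.BalabanUV.Beta.FP.SliceProjectorAliasSum (CS)
open Summit.QuantumFields.BalabanUV.Beta.FP.BlockAveragedKernelLegs (letterDiff_free)
open Summit.QuantumFields.BalabanUV.Beta.FP.PerfectFFBlockRowSum (exists_sum_abs_KPerf_ff_le_col)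
open Summit.QuantumFields.BalabanUV.Beta.FP.PerfectFFBlockRowDiff (sum_abs_KPerf_ff_colDiff_le)
open Summit.QuantumFields.BalabanUV.Beta.FP.LegRemainderGaugeTerm (abs_rho_sub_right_le abs_rho_sub_sub_le nonneg_of_cubic)
open Summit.QuantumFields.BalabanUV.Beta.FP.GaugeTermRoadLegs (letter_S0 letter_S1 window_le CS_exp_nonneg one_le_pow_of_one_lt)

/-! ## §1 Products of constants with a linear Γ-letter -/

/-- [folklore] `(1 + 80n∕κ)·(c·n⁻⁴·(33∕n))·(A₁·n) ≤ (1+80∕κ)·c·33·|A₁|·n⁻³` for `n ≥ 1` (`c ≥ 0`). -/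
theorem prod_zero_lin_le {κ c A₁ : ℝ} (hκ : 0 < κ) (hc : 0 ≤ c) {n : ℕ} (hn : 1 ≤ n) :
    (1 + 80 * (n : ℝ) / κ) * (c * ((n : ℝ) ^ (3 + 1))⁻¹ * (33 / n)) * (A₁ * (n : ℝ))
      ≤ (1 + 80 / κ) * c * 33 * |A₁| / (n : ℝ) ^ 3 := by
  have hn0 : (0 : ℝ) < n := by exact_mod_cast hn
  have hw := window_le hκ hn
  have hA : A₁ ≤ |A₁| := le_abs_self A₁
  have hκ' : 0 ≤ 1 + 80 / κ := by positivity
  calc (1 + 80 * (n : ℝ) / κ) * (c * ((n : ℝ) ^ (3 + 1))⁻¹ * (33 / n)) * (A₁ * (n : ℝ))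
      = (1 + 80 * (n : ℝ) / κ) * A₁ * (c * 33 / (n : ℝ) ^ 4) := by field_simp; ring
    _ ≤ ((1 + 80 / κ) * n) * |A₁| * (c * 33 / (n : ℝ) ^ 4) := by
        have h3 : 0 ≤ c * 33 / (n : ℝ) ^ 4 := by positivity
        have h1 : (1 + 80 * (n : ℝ) / κ) * A₁ ≤ ((1 + 80 / κ) * n) * |A₁| := by
          have hw0 : 0 ≤ 1 + 80 * (n : ℝ) / κ := by positivity
          calc (1 + 80 * (n : ℝ) / κ) * A₁ ≤ (1 + 80 * (n : ℝ) / κ) * |A₁| := mul_le_mul_of_nonneg_left hA hw0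
            _ ≤ ((1 + 80 / κ) * n) * |A₁| := mul_le_mul_of_nonneg_right hw (abs_nonneg _)
        exact mul_le_mul_of_nonneg_right h1 h3
    _ = (1 + 80 / κ) * c * 33 * |A₁| / (n : ℝ) ^ 3 := by field_simp

/-- [folklore] `(1 + 80n∕κ)·(c·n⁻⁴·(33∕n)²)·(A₁·n) ≤ (1+80∕κ)·c·33²·|A₁|·n⁻⁴` for `n ≥ 1` (`c ≥ 0`). -/
theorem prod_one_lin_le {κ c A₁ : ℝ} (hκ : 0 < κ) (hc : 0 ≤ c) {n : ℕ} (hn : 1 ≤ n) :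
    (1 + 80 * (n : ℝ) / κ) * (c * ((n : ℝ) ^ (3 + 1))⁻¹ * (33 / n) ^ 2) * (A₁ * (n : ℝ))
      ≤ (1 + 80 / κ) * c * 33 ^ 2 * |A₁| / (n : ℝ) ^ 4 := by
  have hn0 : (0 : ℝ) < n := by exact_mod_cast hn
  have hw := window_le hκ hn
  have hA : A₁ ≤ |A₁| := le_abs_self A₁
  have hκ' : 0 ≤ 1 + 80 / κ := by positivity
  calc (1 + 80 * (n : ℝ) / κ) * (c * ((n : ℝ) ^ (3 + 1))⁻¹ * (33 / n) ^ 2) * (A₁ * (n : ℝ))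
      = (1 + 80 * (n : ℝ) / κ) * A₁ * (c * 33 ^ 2 / (n : ℝ) ^ 5) := by field_simp; ring
    _ ≤ ((1 + 80 / κ) * n) * |A₁| * (c * 33 ^ 2 / (n : ℝ) ^ 5) := by
        have h3 : 0 ≤ c * 33 ^ 2 / (n : ℝ) ^ 5 := by positivity
        have h1 : (1 + 80 * (n : ℝ) / κ) * A₁ ≤ ((1 + 80 / κ) * n) * |A₁| := by
          have hw0 : 0 ≤ 1 + 80 * (n : ℝ) / κ := by positivity
          calc (1 + 80 * (n : ℝ) / κ) * A₁ ≤ (1 + 80 * (n : ℝ) / κ) * |A₁| := mul_le_mul_of_nonneg_left hA hw0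
            _ ≤ ((1 + 80 / κ) * n) * |A₁| := mul_le_mul_of_nonneg_right hw (abs_nonneg _)
        exact mul_le_mul_of_nonneg_right h1 h3
    _ = (1 + 80 / κ) * c * 33 ^ 2 * |A₁| / (n : ℝ) ^ 4 := by field_simp

/-! ## §2 hR1′ and hR2 of the (R1) gauge term at the road's legs, conditional on the tower letter -/

section Road

variable {Lc : ℕ} [NeZero Lc]

/-- [our object] **`hR1′` OF THE (R1) GAUGE TERM, m-UNIFORM, CONDITIONAL ON THE TOWER LETTER**: for `d = 3`, odd `Lc > 1` and the GRADIENT row-sum letter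
`Σ_j ‖𝒞(i+ê_μ) j − 𝒞 i j‖ ≤ C₁∕N` of the hard covariance on the tower tori, there is ONE `B₁′` with, for every `m ≥ 1`, every `μ ν l j : Fin 4` and all
`p w ∈ ℤ⁴`, `|ρ p (w+e_j) − ρ p w| ≤ B₁′∕((Lc)^m)³` for `ρ p w := Σ'_{(x,q)} F_μ(p−x)·S_ν (Lc^m) x q·KPerf … m q w (inl ν) (inl l)` — RHOA-3's `hR1′` for the gauge term
(engine `abs_rho_sub_right_le` + (T0′) BY NAME + (T1′) from F5b). -/
theorem exists_abs_rho_road_sub_right_le (hLc : Odd Lc ∧ 1 < Lc) {C₁ : ℝ}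
    (hC1 : ∀ P : Params, P.d = 3 + 1 → P.L = Lc → 1 ≤ P.K →
      ∀ (i : Tor (fine (nP P) (MP P)) × Fin P.d) (μ : Fin P.d),
        ∑ j, ‖Cov (nP P) (one_le_nP P) (MP P) 1 one_pos (i.1 + B5Prop11Plancherel.unitVec (fine (nP P) (MP P)) μ, i.2) j
          - Cov (nP P) (one_le_nP P) (MP P) 1 one_pos i j‖ ≤ C₁ / (nP P : ℝ)) :
    ∃ B₁' : ℝ, ∀ m : ℕ, 1 ≤ m → ∀ (μ ν l j : Fin 4) (p w : Pt),
      |(∑' xq : Pt × Pt, (latticeGreen (p - xq.1 + Pi.single μ 1) / 2 - latticeGreen (p - xq.1) / 2)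
            * (piC (d := 3) (Lc ^ m) xq.1 (xq.2 + unitVec ν) - piC (d := 3) (Lc ^ m) xq.1 xq.2).re
            * KPerf (d := 3) Lc (sfStep Lc) (smStep 3 Lc) m xq.2 (w + unitVec j) (Sum.inl ν) (Sum.inl l))
          - ∑' xq : Pt × Pt, (latticeGreen (p - xq.1 + Pi.single μ 1) / 2 - latticeGreen (p - xq.1) / 2)
            * (piC (d := 3) (Lc ^ m) xq.1 (xq.2 + unitVec ν) - piC (d := 3) (Lc ^ m) xq.1 xq.2).re
            * KPerf (d := 3) Lc (sfStep Lc) (smStep 3 Lc) m xq.2 w (Sum.inl ν) (Sum.inl l)|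
        ≤ B₁' / ((Lc : ℝ) ^ m) ^ 3 := by
  obtain ⟨A₀, hA₀⟩ := exists_sum_abs_KPerf_ff_le_col (Lc := Lc) hLc
  have hκ := kapY_pos (3 + 1)
  refine ⟨2 * (8 * (2 * free.U + 2 * c4 + free.Bgrad)) * ((1 + 80 / kapY (3 + 1)) * (CS 3 * Real.exp (kapY (3 + 1))) * 33 * |C₁ / 2|),
    fun m hm μ ν l j p w => ?_⟩
  have hn : 1 ≤ Lc ^ m := one_le_pow_of_one_lt hLc.2 m
  haveI : NeZero (Lc ^ m) := ⟨pow_ne_zero m (NeZero.ne Lc)⟩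
  have hcast : ((Lc ^ m : ℕ) : ℝ) = (Lc : ℝ) ^ m := by push_cast; ring
  have hT0 : ∀ (w : Pt) (Q : Finset Pt),
      ∑ q ∈ Q, |KPerf (d := 3) Lc (sfStep Lc) (smStep 3 Lc) m q w (Sum.inl ν) (Sum.inl l)| ≤ A₀ * (((Lc ^ m : ℕ) : ℝ)) ^ 2 := by
    intro w Q; rw [hcast]; exact hA₀ m hm w ν l Q
  have hT1 : ∀ (w : Pt) (Q : Finset Pt),
      ∑ q ∈ Q, |KPerf (d := 3) Lc (sfStep Lc) (smStep 3 Lc) m q (w + unitVec j) (Sum.inl ν) (Sum.inl l)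
        - KPerf (d := 3) Lc (sfStep Lc) (smStep 3 Lc) m q w (Sum.inl ν) (Sum.inl l)| ≤ C₁ / 2 * (((Lc ^ m : ℕ) : ℝ)) := by
    intro w Q; rw [hcast]; exact sum_abs_KPerf_ff_colDiff_le hLc hC1 hm w j ν l Q
  have h := abs_rho_sub_right_le (F := fun z => latticeGreen (z + Pi.single μ 1) / 2 - latticeGreen z / 2)
    (S := fun x q => (piC (d := 3) (Lc ^ m) x (q + unitVec ν) - piC (d := 3) (Lc ^ m) x q).re)
    (G := fun q w => KPerf (d := 3) Lc (sfStep Lc) (smStep 3 Lc) m q w (Sum.inl ν) (Sum.inl l))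
    hκ hn (letterDiff_free μ) (letter_S0 (Lc ^ m) ν) hT0 (unitVec j) hT1 p w
  refine h.trans ?_
  have hAF : 0 ≤ 2 * (8 * (2 * free.U + 2 * c4 + free.Bgrad)) := by
    have h0 : 0 ≤ 8 * (2 * free.U + 2 * c4 + free.Bgrad) := nonneg_of_cubic (letterDiff_free μ)
    linarith
  have hp := prod_zero_lin_le (A₁ := C₁ / 2) hκ CS_exp_nonneg hn
  rw [hcast] at hp
  calc 2 * (8 * (2 * free.U + 2 * c4 + free.Bgrad)) * (1 + 80 * ((Lc ^ m : ℕ) : ℝ) / kapY (3 + 1))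
        * (CS 3 * Real.exp (kapY (3 + 1)) * (((Lc ^ m : ℕ) : ℝ) ^ (3 + 1))⁻¹ * (33 / ((Lc ^ m : ℕ) : ℝ))) * (C₁ / 2 * (((Lc ^ m : ℕ) : ℝ)))
      = 2 * (8 * (2 * free.U + 2 * c4 + free.Bgrad)) * ((1 + 80 * ((Lc ^ m : ℕ) : ℝ) / kapY (3 + 1))
        * (CS 3 * Real.exp (kapY (3 + 1)) * (((Lc ^ m : ℕ) : ℝ) ^ (3 + 1))⁻¹ * (33 / ((Lc ^ m : ℕ) : ℝ))) * (C₁ / 2 * (((Lc ^ m : ℕ) : ℝ)))) := by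
          ring
    _ ≤ 2 * (8 * (2 * free.U + 2 * c4 + free.Bgrad)) * ((1 + 80 / kapY (3 + 1)) * (CS 3 * Real.exp (kapY (3 + 1))) * 33 * |C₁ / 2| / ((Lc : ℝ) ^ m) ^ 3) := by
          rw [hcast]; exact mul_le_mul_of_nonneg_left hp hAF
    _ = _ := by ring

/-- [our object] **`hR2` OF THE (R1) GAUGE TERM, m-UNIFORM, CONDITIONAL ON THE TOWER LETTER**: one `B₂` with, for every `m ≥ 1`, `μ ν l i j`, `p w`,
`|ρ (p+e_i) (w+e_j) − ρ p (w+e_j) − ρ (p+e_i) w + ρ p w| ≤ B₂∕((Lc)^m)⁴` — RHOA-3's mixed second difference `hR2` for the gauge term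
(engine `abs_rho_sub_sub_le` + `letter_S1` + (T0′) + (T1′)). -/
theorem exists_abs_rho_road_sub_sub_le (hLc : Odd Lc ∧ 1 < Lc) {C₁ : ℝ}
    (hC1 : ∀ P : Params, P.d = 3 + 1 → P.L = Lc → 1 ≤ P.K →
      ∀ (i : Tor (fine (nP P) (MP P)) × Fin P.d) (μ : Fin P.d),
        ∑ j, ‖Cov (nP P) (one_le_nP P) (MP P) 1 one_pos (i.1 + B5Prop11Plancherel.unitVec (fine (nP P) (MP P)) μ, i.2) j
          - Cov (nP P) (one_le_nP P) (MP P) 1 one_pos i j‖ ≤ C₁ / (nP P : ℝ)) :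
    ∃ B₂ : ℝ, ∀ m : ℕ, 1 ≤ m → ∀ (μ ν l i j : Fin 4) (p w : Pt),
      |(∑' xq : Pt × Pt, (latticeGreen (p + unitVec i - xq.1 + Pi.single μ 1) / 2 - latticeGreen (p + unitVec i - xq.1) / 2)
            * (piC (d := 3) (Lc ^ m) xq.1 (xq.2 + unitVec ν) - piC (d := 3) (Lc ^ m) xq.1 xq.2).re
            * KPerf (d := 3) Lc (sfStep Lc) (smStep 3 Lc) m xq.2 (w + unitVec j) (Sum.inl ν) (Sum.inl l))
          - (∑' xq : Pt × Pt, (latticeGreen (p - xq.1 + Pi.single μ 1) / 2 - latticeGreen (p - xq.1) / 2)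
            * (piC (d := 3) (Lc ^ m) xq.1 (xq.2 + unitVec ν) - piC (d := 3) (Lc ^ m) xq.1 xq.2).re
            * KPerf (d := 3) Lc (sfStep Lc) (smStep 3 Lc) m xq.2 (w + unitVec j) (Sum.inl ν) (Sum.inl l))
          - (∑' xq : Pt × Pt, (latticeGreen (p + unitVec i - xq.1 + Pi.single μ 1) / 2 - latticeGreen (p + unitVec i - xq.1) / 2)
            * (piC (d := 3) (Lc ^ m) xq.1 (xq.2 + unitVec ν) - piC (d := 3) (Lc ^ m) xq.1 xq.2).re
            * KPerf (d := 3) Lc (sfStep Lc) (smStep 3 Lc) m xq.2 w (Sum.inl ν) (Sum.inl l))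
          + ∑' xq : Pt × Pt, (latticeGreen (p - xq.1 + Pi.single μ 1) / 2 - latticeGreen (p - xq.1) / 2)
            * (piC (d := 3) (Lc ^ m) xq.1 (xq.2 + unitVec ν) - piC (d := 3) (Lc ^ m) xq.1 xq.2).re
            * KPerf (d := 3) Lc (sfStep Lc) (smStep 3 Lc) m xq.2 w (Sum.inl ν) (Sum.inl l)|
        ≤ B₂ / ((Lc : ℝ) ^ m) ^ 4 := by
  obtain ⟨A₀, hA₀⟩ := exists_sum_abs_KPerf_ff_le_col (Lc := Lc) hLc
  have hκ := kapY_pos (3 + 1)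
  refine ⟨2 * (8 * (2 * free.U + 2 * c4 + free.Bgrad)) * ((1 + 80 / kapY (3 + 1)) * (CS 3 * Real.exp (kapY (3 + 1))) * 33 ^ 2 * |C₁ / 2|),
    fun m hm μ ν l i j p w => ?_⟩
  have hn : 1 ≤ Lc ^ m := one_le_pow_of_one_lt hLc.2 m
  haveI : NeZero (Lc ^ m) := ⟨pow_ne_zero m (NeZero.ne Lc)⟩
  have hcast : ((Lc ^ m : ℕ) : ℝ) = (Lc : ℝ) ^ m := by push_cast; ring
  have hT0 : ∀ (w : Pt) (Q : Finset Pt),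
      ∑ q ∈ Q, |KPerf (d := 3) Lc (sfStep Lc) (smStep 3 Lc) m q w (Sum.inl ν) (Sum.inl l)| ≤ A₀ * (((Lc ^ m : ℕ) : ℝ)) ^ 2 := by
    intro w Q; rw [hcast]; exact hA₀ m hm w ν l Q
  have hT1 : ∀ (w : Pt) (Q : Finset Pt),
      ∑ q ∈ Q, |KPerf (d := 3) Lc (sfStep Lc) (smStep 3 Lc) m q (w + unitVec j) (Sum.inl ν) (Sum.inl l)
        - KPerf (d := 3) Lc (sfStep Lc) (smStep 3 Lc) m q w (Sum.inl ν) (Sum.inl l)| ≤ C₁ / 2 * (((Lc ^ m : ℕ) : ℝ)) := by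
    intro w Q; rw [hcast]; exact sum_abs_KPerf_ff_colDiff_le hLc hC1 hm w j ν l Q
  have h := abs_rho_sub_sub_le (F := fun z => latticeGreen (z + Pi.single μ 1) / 2 - latticeGreen z / 2)
    (S := fun x q => (piC (d := 3) (Lc ^ m) x (q + unitVec ν) - piC (d := 3) (Lc ^ m) x q).re)
    (G := fun q w => KPerf (d := 3) Lc (sfStep Lc) (smStep 3 Lc) m q w (Sum.inl ν) (Sum.inl l))
    hκ hn (letterDiff_free μ) (letter_S0 (Lc ^ m) ν) (unitVec i) (letter_S1 (Lc ^ m) ν i) hT0 (unitVec j) hT1 p w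
  refine h.trans ?_
  have hAF : 0 ≤ 2 * (8 * (2 * free.U + 2 * c4 + free.Bgrad)) := by
    have h0 : 0 ≤ 8 * (2 * free.U + 2 * c4 + free.Bgrad) := nonneg_of_cubic (letterDiff_free μ)
    linarith
  have hp := prod_one_lin_le (A₁ := C₁ / 2) hκ CS_exp_nonneg hn
  rw [hcast] at hp
  calc 2 * (8 * (2 * free.U + 2 * c4 + free.Bgrad)) * (1 + 80 * ((Lc ^ m : ℕ) : ℝ) / kapY (3 + 1))
        * (CS 3 * Real.exp (kapY (3 + 1)) * (((Lc ^ m : ℕ) : ℝ) ^ (3 + 1))⁻¹ * (33 / ((Lc ^ m : ℕ) : ℝ)) ^ 2) * (C₁ / 2 * (((Lc ^ m : ℕ) : ℝ)))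
      = 2 * (8 * (2 * free.U + 2 * c4 + free.Bgrad)) * ((1 + 80 * ((Lc ^ m : ℕ) : ℝ) / kapY (3 + 1))
        * (CS 3 * Real.exp (kapY (3 + 1)) * (((Lc ^ m : ℕ) : ℝ) ^ (3 + 1))⁻¹ * (33 / ((Lc ^ m : ℕ) : ℝ)) ^ 2) * (C₁ / 2 * (((Lc ^ m : ℕ) : ℝ)))) := by
          ring
    _ ≤ 2 * (8 * (2 * free.U + 2 * c4 + free.Bgrad)) * ((1 + 80 / kapY (3 + 1)) * (CS 3 * Real.exp (kapY (3 + 1))) * 33 ^ 2 * |C₁ / 2| / ((Lc : ℝ) ^ m) ^ 4) := by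
          rw [hcast]; exact mul_le_mul_of_nonneg_left hp hAF
    _ = _ := by ring

/-! ## §3 The `ν`-summed gauge-term kernel -/

/-- [our object] **`hR1′` FOR THE `ν`-SUMMED GAUGE TERM**, CONDITIONAL ON THE TOWER LETTER: one constant `4B₁′` for all `m ≥ 1`. -/
theorem exists_abs_sum_rho_road_sub_right_le (hLc : Odd Lc ∧ 1 < Lc) {C₁ : ℝ}
    (hC1 : ∀ P : Params, P.d = 3 + 1 → P.L = Lc → 1 ≤ P.K →
      ∀ (i : Tor (fine (nP P) (MP P)) × Fin P.d) (μ : Fin P.d),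
        ∑ j, ‖Cov (nP P) (one_le_nP P) (MP P) 1 one_pos (i.1 + B5Prop11Plancherel.unitVec (fine (nP P) (MP P)) μ, i.2) j
          - Cov (nP P) (one_le_nP P) (MP P) 1 one_pos i j‖ ≤ C₁ / (nP P : ℝ)) :
    ∃ B₁' : ℝ, ∀ m : ℕ, 1 ≤ m → ∀ (μ l j : Fin 4) (p w : Pt),
      |∑ ν : Fin 4, ((∑' xq : Pt × Pt, (latticeGreen (p - xq.1 + Pi.single μ 1) / 2 - latticeGreen (p - xq.1) / 2)
            * (piC (d := 3) (Lc ^ m) xq.1 (xq.2 + unitVec ν) - piC (d := 3) (Lc ^ m) xq.1 xq.2).re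
            * KPerf (d := 3) Lc (sfStep Lc) (smStep 3 Lc) m xq.2 (w + unitVec j) (Sum.inl ν) (Sum.inl l))
          - ∑' xq : Pt × Pt, (latticeGreen (p - xq.1 + Pi.single μ 1) / 2 - latticeGreen (p - xq.1) / 2)
            * (piC (d := 3) (Lc ^ m) xq.1 (xq.2 + unitVec ν) - piC (d := 3) (Lc ^ m) xq.1 xq.2).re
            * KPerf (d := 3) Lc (sfStep Lc) (smStep 3 Lc) m xq.2 w (Sum.inl ν) (Sum.inl l))|
        ≤ B₁' / ((Lc : ℝ) ^ m) ^ 3 := by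
  obtain ⟨B₁', hB⟩ := exists_abs_rho_road_sub_right_le (Lc := Lc) hLc hC1
  refine ⟨4 * B₁', fun m hm μ l j p w => ?_⟩
  calc _ ≤ ∑ ν : Fin 4, |(∑' xq : Pt × Pt, (latticeGreen (p - xq.1 + Pi.single μ 1) / 2 - latticeGreen (p - xq.1) / 2)
            * (piC (d := 3) (Lc ^ m) xq.1 (xq.2 + unitVec ν) - piC (d := 3) (Lc ^ m) xq.1 xq.2).re
            * KPerf (d := 3) Lc (sfStep Lc) (smStep 3 Lc) m xq.2 (w + unitVec j) (Sum.inl ν) (Sum.inl l))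
          - ∑' xq : Pt × Pt, (latticeGreen (p - xq.1 + Pi.single μ 1) / 2 - latticeGreen (p - xq.1) / 2)
            * (piC (d := 3) (Lc ^ m) xq.1 (xq.2 + unitVec ν) - piC (d := 3) (Lc ^ m) xq.1 xq.2).re
            * KPerf (d := 3) Lc (sfStep Lc) (smStep 3 Lc) m xq.2 w (Sum.inl ν) (Sum.inl l)| := Finset.abs_sum_le_sum_abs _ _
    _ ≤ ∑ _ν : Fin 4, B₁' / ((Lc : ℝ) ^ m) ^ 3 := Finset.sum_le_sum fun ν _ => hB m hm μ ν l j p w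
    _ = 4 * B₁' / ((Lc : ℝ) ^ m) ^ 3 := by rw [Finset.sum_const, Finset.card_univ, Fintype.card_fin]; ring

/-- [our object] **`hR2` FOR THE `ν`-SUMMED GAUGE TERM**, CONDITIONAL ON THE TOWER LETTER: one constant `4B₂` for all `m ≥ 1`. -/
theorem exists_abs_sum_rho_road_sub_sub_le (hLc : Odd Lc ∧ 1 < Lc) {C₁ : ℝ}
    (hC1 : ∀ P : Params, P.d = 3 + 1 → P.L = Lc → 1 ≤ P.K →
      ∀ (i : Tor (fine (nP P) (MP P)) × Fin P.d) (μ : Fin P.d),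
        ∑ j, ‖Cov (nP P) (one_le_nP P) (MP P) 1 one_pos (i.1 + B5Prop11Plancherel.unitVec (fine (nP P) (MP P)) μ, i.2) j
          - Cov (nP P) (one_le_nP P) (MP P) 1 one_pos i j‖ ≤ C₁ / (nP P : ℝ)) :
    ∃ B₂ : ℝ, ∀ m : ℕ, 1 ≤ m → ∀ (μ l i j : Fin 4) (p w : Pt),
      |∑ ν : Fin 4, ((∑' xq : Pt × Pt, (latticeGreen (p + unitVec i - xq.1 + Pi.single μ 1) / 2 - latticeGreen (p + unitVec i - xq.1) / 2)
            * (piC (d := 3) (Lc ^ m) xq.1 (xq.2 + unitVec ν) - piC (d := 3) (Lc ^ m) xq.1 xq.2).re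
            * KPerf (d := 3) Lc (sfStep Lc) (smStep 3 Lc) m xq.2 (w + unitVec j) (Sum.inl ν) (Sum.inl l))
          - (∑' xq : Pt × Pt, (latticeGreen (p - xq.1 + Pi.single μ 1) / 2 - latticeGreen (p - xq.1) / 2)
            * (piC (d := 3) (Lc ^ m) xq.1 (xq.2 + unitVec ν) - piC (d := 3) (Lc ^ m) xq.1 xq.2).re
            * KPerf (d := 3) Lc (sfStep Lc) (smStep 3 Lc) m xq.2 (w + unitVec j) (Sum.inl ν) (Sum.inl l))
          - (∑' xq : Pt × Pt, (latticeGreen (p + unitVec i - xq.1 + Pi.single μ 1) / 2 - latticeGreen (p + unitVec i - xq.1) / 2)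
            * (piC (d := 3) (Lc ^ m) xq.1 (xq.2 + unitVec ν) - piC (d := 3) (Lc ^ m) xq.1 xq.2).re
            * KPerf (d := 3) Lc (sfStep Lc) (smStep 3 Lc) m xq.2 w (Sum.inl ν) (Sum.inl l))
          + ∑' xq : Pt × Pt, (latticeGreen (p - xq.1 + Pi.single μ 1) / 2 - latticeGreen (p - xq.1) / 2)
            * (piC (d := 3) (Lc ^ m) xq.1 (xq.2 + unitVec ν) - piC (d := 3) (Lc ^ m) xq.1 xq.2).re
            * KPerf (d := 3) Lc (sfStep Lc) (smStep 3 Lc) m xq.2 w (Sum.inl ν) (Sum.inl l))|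
        ≤ B₂ / ((Lc : ℝ) ^ m) ^ 4 := by
  obtain ⟨B₂, hB⟩ := exists_abs_rho_road_sub_sub_le (Lc := Lc) hLc hC1
  refine ⟨4 * B₂, fun m hm μ l i j p w => ?_⟩
  calc _ ≤ ∑ ν : Fin 4, |(∑' xq : Pt × Pt, (latticeGreen (p + unitVec i - xq.1 + Pi.single μ 1) / 2 - latticeGreen (p + unitVec i - xq.1) / 2)
            * (piC (d := 3) (Lc ^ m) xq.1 (xq.2 + unitVec ν) - piC (d := 3) (Lc ^ m) xq.1 xq.2).re
            * KPerf (d := 3) Lc (sfStep Lc) (smStep 3 Lc) m xq.2 (w + unitVec j) (Sum.inl ν) (Sum.inl l))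
          - (∑' xq : Pt × Pt, (latticeGreen (p - xq.1 + Pi.single μ 1) / 2 - latticeGreen (p - xq.1) / 2)
            * (piC (d := 3) (Lc ^ m) xq.1 (xq.2 + unitVec ν) - piC (d := 3) (Lc ^ m) xq.1 xq.2).re
            * KPerf (d := 3) Lc (sfStep Lc) (smStep 3 Lc) m xq.2 (w + unitVec j) (Sum.inl ν) (Sum.inl l))
          - (∑' xq : Pt × Pt, (latticeGreen (p + unitVec i - xq.1 + Pi.single μ 1) / 2 - latticeGreen (p + unitVec i - xq.1) / 2)
            * (piC (d := 3) (Lc ^ m) xq.1 (xq.2 + unitVec ν) - piC (d := 3) (Lc ^ m) xq.1 xq.2).re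
            * KPerf (d := 3) Lc (sfStep Lc) (smStep 3 Lc) m xq.2 w (Sum.inl ν) (Sum.inl l))
          + ∑' xq : Pt × Pt, (latticeGreen (p - xq.1 + Pi.single μ 1) / 2 - latticeGreen (p - xq.1) / 2)
            * (piC (d := 3) (Lc ^ m) xq.1 (xq.2 + unitVec ν) - piC (d := 3) (Lc ^ m) xq.1 xq.2).re
            * KPerf (d := 3) Lc (sfStep Lc) (smStep 3 Lc) m xq.2 w (Sum.inl ν) (Sum.inl l)| := Finset.abs_sum_le_sum_abs _ _
    _ ≤ ∑ _ν : Fin 4, B₂ / ((Lc : ℝ) ^ m) ^ 4 := Finset.sum_le_sum fun ν _ => hB m hm μ ν l i j p w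
    _ = 4 * B₂ / ((Lc : ℝ) ^ m) ^ 4 := by rw [Finset.sum_const, Finset.card_univ, Fintype.card_fin]; ring

end Road

end Summit.QuantumFields.BalabanUV.Beta.FP.GaugeTermRoadLegsCol

end
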